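import Summits.AtomisticToContinuum.Crystallization.Theses.PoissonBesselStacking
import Summits.AtomisticToContinuum.Crystallization.Theorems.PricedLinkCensusStackingHingeJ2Neg
import Summits.AtomisticToContinuum.Crystallization.Theorems.PricedLinkCensusStackingHingeLjSummable
import Summits.AtomisticToContinuum.Crystallization.Theorems.PricedLinkCensusStackingHingeLjDomination

/-!
# `LjRegistryDomination` (item stmt-AtomisticToContinuum-3063, route PoissonBesselStacking) holds
(stub `stub_ljRegistryDomination` of line `Sketch`, crux `PricedLinkCensus.StackingHinge`, stmt-AtomisticToContinuum-14993)

The certified-numerics crux of route `PoissonBesselStacking`, shared by the line `Sketch` of crux `StackingHinge` as its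
named dependency: on the box `B = {47/50 ≤ a ≤ 1, 39/50·a ≤ h ≤ 17/20·a}` the Lennard-Jones interlayer registry
couplings `J_k(a, h) = barlowCoupling lennardJones a h k` satisfy

* `Σ_k k |J_k| < ∞` — `PricedHcpWindowsLjSummable.stub_ljSummable` (layer decay `|Φ(H)| ≤ 192/H⁴`,
  `LayeredHull.cake_abs_layerInteraction_le`, after the reindexing `layerInteraction V a h δ k = layerInteraction V a (k h) δ 1`);
* `J₂ < 0` — `PricedHcpWindowsJ2Neg.stub_J2neg` (`J₂ ≤ −c₀` uniformly, from `LayeredHull.stub_registry`: the coupling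
  `H ↦ barlowCoupling lennardJones a H 1` is `≤ 0`, non-decreasing on `H ≥ 39a/25`, with a positive corner gap);
* `Σ_{k ≥ 3} (k − 1)|J_k| ≤ |J₂|/2` — `PricedHcpWindowsLjDomination.stub_ljDomination` (Bernstein–Gaussian representation
  `LayeredHull.reg_barlowCoupling_eq_integral`, Poisson dual bound of the registry theta difference
  `G(u) ≤ (38/u) e^{−13.159/u}`, certified one-point lower bound `−D_a(17a/10) ≥ (1797/10⁷)/(12 a⁶)`; margin `2.6`).

This file only assembles the three landed conjuncts into the item's statement BY NAME. [folklore]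
-/

namespace Summit.AtomisticToContinuum.Crystallization.Theorems.PricedHcpWindowsLjRegistry

/-- **Item stmt-AtomisticToContinuum-3063 `PoissonBesselStacking.LjRegistryDomination`** (registered stub
`stub_ljRegistryDomination` of crux stmt-AtomisticToContinuum-14993): summability, strict negativity of `J₂`, and the
Hägg half-domination of the Lennard-Jones registry couplings on the box. [folklore] -/
theorem stub_ljRegistryDomination : Summit.AtomisticToContinuum.Crystallization.Theses.PoissonBesselStacking.LjRegistryDomination := by
  intro a h h1 h2 h3 h4
  obtain ⟨c₀, hc₀, hJ⟩ := PricedHcpWindowsJ2Neg.stub_J2neg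
  exact ⟨PricedHcpWindowsLjSummable.stub_ljSummable a h h1 h2 h3 h4, by linarith [hJ a h h1 h2 h3 h4],
    PricedHcpWindowsLjDomination.stub_ljDomination a h h1 h2 h3 h4⟩

/-- The item's statement under its route name, for `--by` closure of stmt-AtomisticToContinuum-3063. [folklore] -/
theorem ljRegistryDomination_proof : Summit.AtomisticToContinuum.Crystallization.Theses.PoissonBesselStacking.LjRegistryDomination :=
  stub_ljRegistryDomination

end Summit.AtomisticToContinuum.Crystallization.Theorems.PricedHcpWindowsLjRegistry
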